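/-
Copyright (c) 2026 the pub-hodgecm-mathlib formalisation cell (harness21).  Prover seat hodgecm-mathlib-LH4-p01 (g10): road M6 → F3 «TOT-Λ BY OVER-ORDERS» (LEAD F0P3a-plan
T14-66 ∕ T15-32 «GO-LOW»), brick (B2d) «PAIR PACKAGE AT THE INERT PLACE» — WILD UNIT ROW core — for the F5 pen LH7-p04 (g12) (offer 02:35:29Z) and (B2b-II) LH10-p01 (g11); 2026-09-03.
-/
import Literature.NumberTheory.Rogawski1990.TypeTwoGateInertPlaceUniformiser               -- ★ ED. 2 p853341 (this seat): `gateV_inertPlace_uniformiserRow` (brings ★ F5-(0), ★ FILE A∕B∕C, ★ C8)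
import Literature.NumberTheory.Rogawski1990.InertPlaceThetaPackageWildUnitInvolution        -- ★ p853340 (this seat): `exists_thetaPackage_wildUnitRow_involution`
import Literature.NumberTheory.Automorphic.StarPolynomialOfPair                             -- ★ D′β p853212 (this seat): `exists_starPoly_of_unitary`
import Literature.NumberTheory.Automorphic.TypeTwoPairOfEisensteinData                      -- ★ FILE D p853172 (this seat): `trace_fin_two_mem_integer`, `det_fin_two_mem_integer`
import Literature.NumberTheory.NumberFields.RamifiedQuadraticDictionaryWild                 -- ★ (G) `exists_isSquare_inv_mul_coe_of_ne_zero` (a global representative of a local square class, any `p`)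
import Literature.NumberTheory.NumberFields.QuadraticCompletionAtNonsplitPlace                -- ★ (QM) `numberField_adjoinRoot`, `isQuadraticExtension_adjoinRoot`, `exists_algEquiv_root_eq_neg`, `not_isSquare_of_not_isSquare_algebraMap`
import HarnessLib

/-!
# The type-(2) pair package at an inert CM place, wild unit row: the eigen-field model, the θ-package, the endoscopic frame, the root, the ⋆-polynomial and the gate

Topic `NumberTheory/Rogawski1990`; namespace `Literature.NumberTheory.Rogawski1990`.  THEOREMS ONLY (no definition, no instance, no notation, no named fact, no `sorry`).
Cell `pub/hodgecm-mathlib` (D-0151), crux H413 = `stmt-HodgeConjecture-24833`; road M6 → F3 «TOT-Λ by over-orders», brick **(B2d) core, WILD UNIT ROW** (twin of ★ `TypeTwoPairPackageInertPlaceUniformiser`).  ★ F5-(0)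
`ncard_isSelfDualLattice_stable_eq_phiTHn_inertPlace ∕ _phiTHprimen_inertPlace` (p853304) count the self-dual lattices stable under a type-(2) pair `(g, u)` at an inert place
from BINDERS that are not the pair's own data: an auxiliary number field `M ⊇ E` with a place `w₁ ∣ w` (`M_{w₁} = E_w[λ]` the ramified quadratic eigen-algebra), the row's
θ-package (`aF k₀ θ s̃` + 8 letters), the endoscopic frame `φ` (`φ(u, λ) = φ_b(g, u)`, injective, `⋆`-compatible), the root `λ` with the Krylov unit and coordinates, an integral
⋆-polynomial `P`, and the `Valued`∕Krylov gate `hgateV`.  THIS FILE PRODUCES ALL OF THEM in ONE existential, on the WILD UNIT ROW — i.e. from the skew square root of the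
discriminant `4·det g = tr g·tr g − y·y·ι(d_F)`, `d_F = 1 + w_F`, `|4| < |w_F| = q^{−(2k+1)}`, `σ_w y = −y·σ_w(det g)` (★ α2 `exists_skew_sqrt_discriminant_wildUnit`'s letters) — given the place, the form
`J ∈ GL₃(𝒪_w)` hermitian, the block frame `(cfr, φ_b)`, the integral pair with `u·σ_w u = 1`, `(σ_w φ_b(g,u))ᵀ·J·φ_b(g,u) = J`, the torus identities `det g·σ_w det g = 1`,
`σ_w tr g = tr g·σ_w det g`, and the Eisenstein letters `Θ = α•1 + β•g`, `|det Θ| = |ϖ|`, `|tr Θ| < 1` (for `χ_g` rootless, `g₁₀ ≠ 0`).  ASSEMBLY (all ★): a global `m ∈ E` in the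
square class of `ι d_F` (★ (G)), `M := E(√m) = AdjoinRoot (X² − m)` with its involution (★ (QM)), `w₁ ∣ w`; the θ-package with `ι′` (★ `exists_thetaPackage_wildUnitRow_involution`:
`θ = (α − 1)∕ι₁ϖ^k`, `α² = ι₁ι d_F`); `λ := (ι₁ tr g + ι₁ y·α)∕2` — a root of `χ_g` with `λ·s̃λ = 1` (the torus identities) and `M_{w₁} = E_w ⊕ E_w λ`; the endoscopic frame (★ FILE B `exists_endoscopicFrame_of_blockFrame_unitary`);
the integral frame (★ FILE A) and the ⋆-polynomial (★ D′β `exists_starPoly_of_unitary`, `|λ| ≤ 1` from the monic integral equation); the gate (★ `gateV_inertPlace_wildUnitRow`).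
HONEST LABEL: HC_CM is proved only modulo the 2 remaining named inputs (hLiu418 24832, h413 24833) until rung 0 closes; assembly of ★ bricks, asserts nothing printed;
count-neutral (pays no organ; zero label movement until F5 ★ and a desk-priced rider).

* **`exists_pairPackage_inertPlace_wildUnitRow`** (and `…_of_model`).

## References
* [Rogawski1990] J. D. Rogawski, *Automorphic Representations of Unitary Groups in Three Variables*, Ann. of Math. Stud. 123 (1990): §4.9 Lemma 4.9.3 p. 56, Prop. 4.9.1 (b) p. 55.
* [Kottwitz1986BaseChangeUnits] R. E. Kottwitz, *Base change for unit elements of Hecke algebras*, Compositio Math. 60 (1986): §1 pp. 240–241, §3.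
* [Flicker1998UnitaryFL] Y. Z. Flicker, *Elementary proof of the fundamental lemma for a unitary group*, Canad. J. Math. 50 (1998): Props. 7, 11, Theorem 18 p. 97.
* [Neukirch1999] J. Neukirch, *Algebraic Number Theory*, Grundlehren 322 (1999): Ch. II (3.4) (approximation), (5.7)–(5.8), §8.
* [SerreLocalFields1979] J.-P. Serre, *Local Fields*, GTM 67 (1979): Ch. I §6, Ch. V §2 Prop. 3.
-/

set_option autoImplicit false

noncomputable section

open Matrix Polynomial ValuativeRel NumberField IsDedekindDomain
open scoped MatrixGroups ValuativeRel Pointwise WithZero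
open Literature.NumberTheory.Automorphic Literature.NumberTheory.Automorphic.UnitaryGroup Literature.NumberTheory.NumberFields
  Literature.NumberTheory.Rogawski1990.Flicker1998 Literature.NumberTheory.Automorphic.UnitaryLatticeTree Literature.NumberTheory.Automorphic.HermitianLattice

namespace Literature.NumberTheory.Rogawski1990

/-- **(B2d) THE PAIR PACKAGE AT AN INERT PLACE, WILD UNIT ROW — for a GIVEN eigen-field model** `M = E(δ)`, `δ² = m`, `(ι d_F)⁻¹·m ∈ (E_w^×)²`, `w₁ ∣ w`: in the letters of
★ F5-(0) `ncard_isSelfDualLattice_stable_eq_phiTHn_inertPlace` VERBATIM — the θ-package `aF k₀ θ s̃` (12 letters), the endoscopic frame `φ` (`Injective φ`, `hstar`), the root `λ`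
(`hlam hφx hK hall hcoordlam`), an integral ⋆-polynomial `P` (`hP hPx`) and the gate `hgateV`.
[cite: Rogawski1990, §4.9 Lemma 4.9.3 p. 56, Prop. 4.9.1 (b) p. 55] [cite: SerreLocalFields1979, Ch. I §6; Ch. V §2 Prop. 3] [cite: Neukirch1999, Ch. II (5.7)] -/
theorem exists_pairPackage_inertPlace_wildUnitRow_of_model
    {F E : Type} [Field F] [NumberField F] [Field E] [NumberField E] [Algebra F E] [Algebra.IsQuadraticExtension F E]
    (c : E ≃ₐ[F] E) (v : HeightOneSpectrum (𝓞 F)) (hc : c ≠ 1) (hunr : Algebra.IsUnramifiedIn (𝓞 E) v.asIdeal)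
    (w : PlacesOver E v) (hw : c • w.1 = w.1)
    -- the form and the block frame
    (J : GL (Fin 3) (w.1.adicCompletion E)) (hJ : J ∈ glInt 3 (w.1.adicCompletion E))
    (hJh : ((J : Matrix (Fin 3) (Fin 3) (w.1.adicCompletion E)).map (galAdicCompletionMap (L := E) c hw))ᵀ = J)
    (cfr : GL (Fin 3) (w.1.adicCompletion E))
    (φb : (Matrix (Fin 2) (Fin 2) (w.1.adicCompletion E) × w.1.adicCompletion E) →ₐ[w.1.adicCompletion E] Matrix (Fin 3) (Fin 3) (w.1.adicCompletion E))
    (hφb : ∀ (g : Matrix (Fin 2) (Fin 2) (w.1.adicCompletion E)) (u : w.1.adicCompletion E),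
      φb (g, u) = (cfr : Matrix (Fin 3) (Fin 3) (w.1.adicCompletion E)) *
        Matrix.reindex endoPerm endoPerm (Matrix.fromBlocks g 0 0 (u • (1 : Matrix (Fin 1) (Fin 1) (w.1.adicCompletion E)))) *
        ((cfr⁻¹ : GL (Fin 3) (w.1.adicCompletion E)) : Matrix (Fin 3) (Fin 3) (w.1.adicCompletion E)))
    -- the integral unitary pair, its torus identities, its Eisenstein letters
    {g : Matrix (Fin 2) (Fin 2) (w.1.adicCompletion E)} {u : w.1.adicCompletion E}
    (hg : ∀ i j, g i j ∈ 𝒪[w.1.adicCompletion E]) (hu : u ∈ 𝒪[w.1.adicCompletion E]) (hσu : u * galAdicCompletionMap (L := E) c hw u = 1)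
    (hτJ : ((φb (g, u)).map (galAdicCompletionMap (L := E) c hw))ᵀ * (J : Matrix (Fin 3) (Fin 3) (w.1.adicCompletion E)) * φb (g, u) = J)
    (hσD : g.det * galAdicCompletionMap (L := E) c hw g.det = 1)
    (hσt : galAdicCompletionMap (L := E) c hw g.trace = g.trace * galAdicCompletionMap (L := E) c hw g.det)
    {ϖ : w.1.adicCompletion E} (hϖ : Valued.v ϖ = WithZero.exp (-1 : ℤ))
    {Θ : Matrix (Fin 2) (Fin 2) (w.1.adicCompletion E)} {α β : w.1.adicCompletion E}
    (hΘ : Θ = α • 1 + β • g) (hΘd : Valued.v Θ.det = Valued.v ϖ) (hΘt : Valued.v Θ.trace < 1)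
    -- ROW W: ★ α2's skew square root of the discriminant
    {y : w.1.adicCompletion E} {dF wF : v.adicCompletion F} {k : ℕ} (hy0 : y ≠ 0) (hdw : dF = 1 + wF)
    (hwF : Valued.v wF = WithZero.exp (-(2 * (k : ℤ) + 1))) (h4 : Valued.v (4 : v.adicCompletion F) < Valued.v wF)
    (hD4 : 4 * g.det = g.trace * g.trace - y * y * toPlace v w dF)
    (hσy : galAdicCompletionMap (L := E) c hw y = -(y * galAdicCompletionMap (L := E) c hw g.det))
    {ϖF : v.adicCompletion F} (hϖF : Valued.v ϖF = WithZero.exp (-1 : ℤ))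
    -- the eigen-field MODEL (★ (G) + ★ (QM) supply one: `exists_pairPackage_inertPlace_wildUnitRow`)
    {M : Type} [Field M] [NumberField M] [Algebra E M] [Algebra.IsQuadraticExtension E M] (σM : M ≃ₐ[E] M) {δ : M} (hσδ : σM δ = -δ) (hδ : δ ≠ 0)
    {m : E} (hm : algebraMap E M m = δ ^ 2) (hdm : IsSquare ((toPlace v w dF)⁻¹ * (m : w.1.adicCompletion E))) (w₁ : PlacesOver M w.1) :
    ∃ (aF k₀ : v.adicCompletion F) (θ : w₁.1.adicCompletion M) (s' : w₁.1.adicCompletion M →+* w₁.1.adicCompletion M)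
      (φ : (w.1.adicCompletion E × w₁.1.adicCompletion M) →ₐ[w.1.adicCompletion E] Matrix (Fin 3) (Fin 3) (w.1.adicCompletion E))
      (lam : w₁.1.adicCompletion M) (P : (w.1.adicCompletion E)[X]),
      -- the θ-package (★ F5-(0)'s letters `haF hk₀ hθ hθv hcoord hint hs'ι hs'θ hs's' hs'O hs'v hnorm1`)
      (Valued.v aF < 1 ∧ Valued.v k₀ = WithZero.exp (-1 : ℤ) ∧
        θ ^ 2 = toPlace w.1 w₁ (toPlace v w aF) * θ + toPlace w.1 w₁ (toPlace v w k₀) ∧ Valued.v θ = WithZero.exp (-1 : ℤ) ∧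
        (∀ z : w₁.1.adicCompletion M, ∃! pq : w.1.adicCompletion E × w.1.adicCompletion E, z = toPlace w.1 w₁ pq.1 + toPlace w.1 w₁ pq.2 * θ) ∧
        (∀ p q : w.1.adicCompletion E, toPlace w.1 w₁ p + toPlace w.1 w₁ q * θ ∈ 𝒪[w₁.1.adicCompletion M] ↔
          p ∈ 𝒪[w.1.adicCompletion E] ∧ q ∈ 𝒪[w.1.adicCompletion E]) ∧
        (∀ x, s' (toPlace w.1 w₁ x) = toPlace w.1 w₁ (galAdicCompletionMap (L := E) c hw x)) ∧ s' θ = θ ∧ (∀ z, s' (s' z) = z) ∧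
        (∀ z : 𝒪[w₁.1.adicCompletion M], s' z ∈ 𝒪[w₁.1.adicCompletion M]) ∧ (∀ z, Valued.v (s' z) = Valued.v z) ∧
        (∀ c₁ : w₁.1.adicCompletion M, c₁ ≠ 0 → s' c₁ = c₁ → Even (WithZero.log (Valued.v c₁)) → ∃ a : w₁.1.adicCompletion M, a * s' a * c₁ = 1)) ∧
      -- the endoscopic frame (`hφ hstar`)
      (Function.Injective φ ∧
        (∀ b : w.1.adicCompletion E × w₁.1.adicCompletion M, (J : Matrix (Fin 3) (Fin 3) (w.1.adicCompletion E)) *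
          φ (RingHom.prodMap (galAdicCompletionMap (L := E) c hw) s' b) = ((φ b).map (galAdicCompletionMap (L := E) c hw))ᵀ * J)) ∧
      -- the root (`hlam hφx hK hall hcoordlam`)
      (lam ^ 2 - toPlace w.1 w₁ g.trace * lam + toPlace w.1 w₁ g.det = 0 ∧
        φ ((u, lam) : w.1.adicCompletion E × w₁.1.adicCompletion M) = φb (g, u) ∧
        IsUnit (Matrix.of fun i j : Fin 3 => (((φb (g, u)) ^ (j : ℕ)) *ᵥ ((cfr : Matrix (Fin 3) (Fin 3) (w.1.adicCompletion E)) *ᵥ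
          (Pi.single (endoPerm (Sum.inl 0)) (1 : w.1.adicCompletion E) + Pi.single (endoPerm (Sum.inr 0)) (1 : w.1.adicCompletion E)))) i).det ∧
        (∀ x : w.1.adicCompletion E × w₁.1.adicCompletion M, ∃ Q : (w.1.adicCompletion E)[X],
          aeval ((u, lam) : w.1.adicCompletion E × w₁.1.adicCompletion M) Q = x) ∧
        (∀ z : w₁.1.adicCompletion M, ∃ p q : w.1.adicCompletion E, z = toPlace w.1 w₁ p + toPlace w.1 w₁ q * lam)) ∧
      -- the ⋆-polynomial (`hP hPx`)
      ((∀ i, P.coeff i ∈ 𝒪[w.1.adicCompletion E]) ∧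
        aeval ((u, lam) : w.1.adicCompletion E × w₁.1.adicCompletion M) P = (galAdicCompletionMap (L := E) c hw u, s' lam)) ∧
      -- the gate (`hgateV`)
      (∀ (u' p' q' t' D' : w.1.adicCompletion E) (N'' b' : ℕ),
        ((u', toPlace w.1 w₁ p' + toPlace w.1 w₁ q' * θ) : w.1.adicCompletion E × w₁.1.adicCompletion M) *
          RingHom.prodMap (galAdicCompletionMap (L := E) c hw) s'
            ((u', toPlace w.1 w₁ p' + toPlace w.1 w₁ q' * θ) : w.1.adicCompletion E × w₁.1.adicCompletion M) = 1 →
        Valued.v (u' - 1) < 1 → Valued.v (p' - 1) < 1 → Valued.v q' = WithZero.exp (-(N'' : ℤ)) →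
        (toPlace w.1 w₁ p' + toPlace w.1 w₁ q' * θ) ^ 2 - toPlace w.1 w₁ t' * (toPlace w.1 w₁ p' + toPlace w.1 w₁ q' * θ) + toPlace w.1 w₁ D' = 0 →
        Valued.v (u' * u' - t' * u' + D') = WithZero.exp (-(b' : ℤ)) →
        ((∃ x : Fin 3 → w.1.adicCompletion E, ∃ g₁ ∈ unitaryGroupOfForm (galAdicCompletionMap (L := E) c hw) (J : Matrix (Fin 3) (Fin 3) (w.1.adicCompletion E)),
          Submodule.span 𝒪[w.1.adicCompletion E] (Set.range fun k : Fin 3 =>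
            ((φ ((u', toPlace w.1 w₁ p' + toPlace w.1 w₁ q' * θ) : w.1.adicCompletion E × w₁.1.adicCompletion M)) ^ (k : ℕ)) *ᵥ x) =
            Submodule.span 𝒪[w.1.adicCompletion E] (Set.range ((g₁ : Matrix (Fin 3) (Fin 3) (w.1.adicCompletion E)))ᵀ)) ↔
        Even (WithZero.log (Valued.v (∑ k, ∑ i,
          galAdicCompletionMap (L := E) c hw (((cfr : Matrix (Fin 3) (Fin 3) (w.1.adicCompletion E)) *ᵥ Pi.single (endoPerm (Sum.inr 0)) (1 : w.1.adicCompletion E)) i) *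
          (J : Matrix (Fin 3) (Fin 3) (w.1.adicCompletion E)) i k *
          ((cfr : Matrix (Fin 3) (Fin 3) (w.1.adicCompletion E)) *ᵥ Pi.single (endoPerm (Sum.inr 0)) (1 : w.1.adicCompletion E)) k)) + b'))) := by
  -- ### 0. The place: `σ = σ_w`, valuations, `χ_g` rootless, the row's letters read in `E_w`
  have hσσ : ∀ x, galAdicCompletionMap (L := E) c hw (galAdicCompletionMap (L := E) c hw x) = x :=
    galAdicCompletionMap_galAdicCompletionMap_of_smul_eq c w hc hw
  have hιv : ∀ z : v.adicCompletion F, Valued.v (toPlace v w z) = Valued.v z :=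
    fun z => Literature.NumberTheory.Automorphic.Liu2021.LemD1IndexedNonVacuityInertCofinite.valued_toPlace_of_isUnramifiedIn E v hunr w z
  have hdw' : toPlace v w dF = 1 + toPlace v w wF := by rw [hdw, map_add, map_one]
  have hw₀' : Valued.v (toPlace v w wF) = WithZero.exp (-(2 * (k : ℤ) + 1)) := by rw [hιv, hwF]
  have h4' : Valued.v (4 : w.1.adicCompletion E) < Valued.v (toPlace v w wF) := by rw [← map_ofNat (toPlace v w) 4, hιv, hιv]; exact h4
  have hϖ' : Valued.v (toPlace v w ϖF) = WithZero.exp (-1 : ℤ) := by rw [hιv, hϖF]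
  have hσd : galAdicCompletionMap (L := E) c hw (toPlace v w dF) = toPlace v w dF := galAdicCompletionMap_toPlace c w w hw dF
  have hσϖ' : galAdicCompletionMap (L := E) c hw (toPlace v w ϖF) = toPlace v w ϖF := galAdicCompletionMap_toPlace c w w hw ϖF
  have hπ0 : toPlace v w ϖF ≠ 0 := fun h0 => by rw [h0, map_zero] at hϖ'; exact WithZero.zero_ne_coe hϖ'
  obtain ⟨-, -, hirr, h10⟩ := charpoly_ne_zero_of_eisensteinData hϖ hΘ hΘd hΘt
  have hu0 : u ≠ 0 := fun h0 => by rw [h0, zero_mul] at hσu; exact zero_ne_one hσu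
  haveI : CharZero (w.1.adicCompletion E) := charZero_of_injective_algebraMap (algebraMap E (w.1.adicCompletion E)).injective
  -- ### 2. The θ-package with its second involution (★ `exists_thetaPackage_wildUnitRow_involution`)
  obtain ⟨aF, k₀, θ, s', ι', αr, ⟨-, -, haF, hk₀, ⟨hαr, hθα⟩, hθv, hθ, hcoord, hint, hs'ι, hs'θ, hs's', hs'O, hs'v, hnorm1⟩, ⟨hι'j, hι'α, hι'ι, -, hι'v, hcomm⟩,
      hfix, hrE, hnE, hι'θne⟩ :=
    exists_thetaPackage_wildUnitRow_involution c v hc hunr w hw σM hσδ hδ hm hdw' hw₀' h4' hdm hϖ' hσd hσϖ' w₁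
  have hPk0 : toPlace w.1 w₁ (toPlace v w ϖF) ^ k ≠ 0 := pow_ne_zero _ ((_root_.map_ne_zero _).2 hπ0)
  have hs'α : s' αr = αr := by
    have hαθ : αr = θ * toPlace w.1 w₁ (toPlace v w ϖF) ^ k + 1 := by rw [hθα, div_mul_cancel₀ _ hPk0, sub_add_cancel]
    rw [hαθ, map_add, map_mul, map_pow, hs'θ, hs'ι, hσϖ', map_one]
  -- ### 3. The root `λ := (ι₁ tr g + ι₁ y·α)∕2`, `α² = ι₁ι d_F`
  haveI : CharZero (w₁.1.adicCompletion M) :=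
    charZero_of_injective_algebraMap (algebraMap M _).injective
  obtain ⟨lam, hlamdef⟩ : ∃ lam : w₁.1.adicCompletion M, lam = (toPlace w.1 w₁ g.trace + toPlace w.1 w₁ y * αr) / 2 := ⟨_, rfl⟩
  have h2lam : 2 * lam = toPlace w.1 w₁ g.trace + toPlace w.1 w₁ y * αr := by rw [hlamdef, mul_div_cancel₀ _ two_ne_zero]
  have h4 : (4 : w₁.1.adicCompletion M) ≠ 0 := by
    rw [show (4 : w₁.1.adicCompletion M) = 2 * 2 by norm_num]; exact mul_ne_zero two_ne_zero two_ne_zero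
  have hD4' : 4 * toPlace w.1 w₁ g.det = toPlace w.1 w₁ g.trace * toPlace w.1 w₁ g.trace - toPlace w.1 w₁ y * toPlace w.1 w₁ y * αr ^ 2 := by
    have h := congrArg (toPlace w.1 w₁) hD4
    rw [map_mul, map_sub, map_mul, map_mul, map_mul, map_ofNat] at h
    rw [h, hαr]
  have hlam : lam ^ 2 - toPlace w.1 w₁ g.trace * lam + toPlace w.1 w₁ g.det = 0 := by
    apply mul_left_cancel₀ h4
    linear_combination (2 * lam - toPlace w.1 w₁ g.trace + toPlace w.1 w₁ y * αr) * h2lam + hD4'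
  have hs'lam : lam * s' lam = 1 := by
    have h2 : s' 2 = 2 := map_ofNat s' 2
    have hs2 : s' lam * 2 = toPlace w.1 w₁ (galAdicCompletionMap (L := E) c hw g.det) * (toPlace w.1 w₁ g.trace - toPlace w.1 w₁ y * αr) := by
      rw [← h2, ← map_mul, mul_comm, h2lam, map_add, map_mul, hs'ι, hs'ι, hs'α, hσt, hσy, map_mul, map_neg, map_mul]; ring
    apply mul_left_cancel₀ h4
    have hσD' : toPlace w.1 w₁ g.det * toPlace w.1 w₁ (galAdicCompletionMap (L := E) c hw g.det) = 1 := by rw [← map_mul, hσD, map_one]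
    linear_combination (toPlace w.1 w₁ (galAdicCompletionMap (L := E) c hw g.det) * (toPlace w.1 w₁ g.trace - toPlace w.1 w₁ y * αr)) * h2lam +
      (2 * lam) * hs2 - toPlace w.1 w₁ (galAdicCompletionMap (L := E) c hw g.det) * hD4' + 4 * hσD'
  have hy1 : toPlace w.1 w₁ y ≠ 0 := (_root_.map_ne_zero _).2 hy0
  have hθlam : θ = (2 * lam - toPlace w.1 w₁ g.trace - toPlace w.1 w₁ y) / (toPlace w.1 w₁ y * toPlace w.1 w₁ (toPlace v w ϖF) ^ k) := by
    rw [eq_div_iff (mul_ne_zero hy1 hPk0), hθα, h2lam]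
    field_simp
    ring
  have hcoordlam : ∀ z : w₁.1.adicCompletion M, ∃ p q : w.1.adicCompletion E, z = toPlace w.1 w₁ p + toPlace w.1 w₁ q * lam := by
    intro z
    obtain ⟨⟨p, q⟩, hz, -⟩ := hcoord z
    refine ⟨p - q * (g.trace + y) / (y * toPlace v w ϖF ^ k), 2 * q / (y * toPlace v w ϖF ^ k), ?_⟩
    rw [hz, hθlam, map_sub, map_div₀, map_mul, map_add, map_mul, map_pow, map_div₀, map_mul, map_mul, map_pow, map_ofNat]
    field_simp
    ring
  have hx₀ : ((u, lam) : w.1.adicCompletion E × w₁.1.adicCompletion M) * (galAdicCompletionMap (L := E) c hw u, s' lam) = 1 :=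
    Prod.ext hσu hs'lam
  -- ### 4. The endoscopic frame (★ FILE B)
  obtain ⟨φ', hφ'inj, hφ'x, hK, hall, hstar⟩ :=
    exists_endoscopicFrame_of_blockFrame_unitary cfr φb hφb (galAdicCompletionMap (L := E) c hw) s' hs'ι g u h10 hu0 hirr lam hlam hcoordlam
      (J : Matrix (Fin 3) (Fin 3) (w.1.adicCompletion E)) hτJ hx₀
  -- ### 5. The integral frame (★ FILE A) and the ⋆-polynomial (★ D′β)
  obtain ⟨ιO, σO, jO, σKO, thetaO, aFO, k₀F, -, -, -, -, hιOc, hσOc, hjOc, hσKOc, -, haFc, hk₀c, -, -, -, -, -, -, -, -, hθO, haFO, hk₀O, hcoordO, -⟩ :=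
    exists_integralEisensteinFrame_inertPlace c v hc hunr w hw w₁ haF hk₀ s' hθ hcoord hint hs'ι hs'θ hs'O hs'v hnorm1
  have hunitE : ∀ x : 𝒪[w.1.adicCompletion E], IsUnit x ↔ Valued.v (x : w.1.adicCompletion E) = 1 := fun x => by
    rw [(Valuation.integer.integers (valuation (w.1.adicCompletion E))).isUnit_iff_valuation_eq_one, v_eq_one_iff_valuation_eq_one]; rfl
  have hmaxE : ∀ x : 𝒪[w.1.adicCompletion E], Valued.v (x : w.1.adicCompletion E) < 1 → x ∈ IsLocalRing.maximalIdeal 𝒪[w.1.adicCompletion E] :=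
    fun x hx => by rw [IsLocalRing.mem_maximalIdeal, mem_nonunits_iff, hunitE]; exact hx.ne
  have haO : ιO aFO ∈ IsLocalRing.maximalIdeal 𝒪[w.1.adicCompletion E] := hmaxE _ (by rw [hιOc, haFc, hιv]; exact haF)
  have hkO : ιO k₀F ∈ IsLocalRing.maximalIdeal 𝒪[w.1.adicCompletion E] := hmaxE _ (by
    rw [hιOc, hk₀c, hιv, hk₀, ← WithZero.exp_zero]; exact WithZero.exp_lt_exp.2 (by norm_num))
  -- `|λ| ≤ 1` (a root of a monic integral quadratic)
  have htO : toPlace w.1 w₁ g.trace ∈ 𝒪[w₁.1.adicCompletion M] := by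
    have h := (hint g.trace 0).2 ⟨trace_fin_two_mem_integer hg, zero_mem _⟩; rwa [map_zero, zero_mul, add_zero] at h
  have hDO : toPlace w.1 w₁ g.det ∈ 𝒪[w₁.1.adicCompletion M] := by
    have h := (hint g.det 0).2 ⟨det_fin_two_mem_integer hg, zero_mem _⟩; rwa [map_zero, zero_mul, add_zero] at h
  have hlamO : lam ∈ 𝒪[w₁.1.adicCompletion M] := by
    rw [← v_le_one_iff_mem_integer]
    by_contra hgt
    rw [not_le] at hgt
    have hsq : lam ^ 2 = toPlace w.1 w₁ g.trace * lam - toPlace w.1 w₁ g.det := by linear_combination hlam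
    have h1 : Valued.v (lam ^ 2) ≤ Valued.v lam := by
      rw [hsq]
      refine Valuation.map_sub_le _ ?_ ?_
      · rw [map_mul]; exact mul_le_of_le_one_left zero_le ((v_le_one_iff_mem_integer _).2 htO)
      · exact ((v_le_one_iff_mem_integer _).2 hDO).trans hgt.le
    rw [map_pow, pow_two] at h1
    exact absurd (lt_mul_of_one_lt_left (zero_lt_one.trans hgt) hgt) (not_lt.2 h1)
  have hxstar : ((⟨u, hu⟩, ⟨lam, hlamO⟩) : 𝒪[w.1.adicCompletion E] × 𝒪[w₁.1.adicCompletion M]) *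
      RingHom.prodMap σO σKO (⟨u, hu⟩, ⟨lam, hlamO⟩) = 1 :=
    by
    change ((⟨u, hu⟩, ⟨lam, hlamO⟩) : 𝒪[w.1.adicCompletion E] × 𝒪[w₁.1.adicCompletion M]) * (σO ⟨u, hu⟩, σKO ⟨lam, hlamO⟩) = 1
    rw [Prod.mk_mul_mk, Prod.mk_eq_one]
    exact ⟨Subtype.ext (by rw [Subring.coe_mul, hσOc, Subring.coe_one]; exact hσu), Subtype.ext (by rw [Subring.coe_mul, hσKOc, Subring.coe_one]; exact hs'lam)⟩
  obtain ⟨P, hP, hPx⟩ := exists_starPoly_of_unitary jO hjOc thetaO (galAdicCompletionMap (L := E) c hw) s' σO hσOc σKO hσKOc hθO haO hkO hcoordO hxstar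
  -- ### 6. The gate on the wild unit row (★ `gateV_inertPlace_wildUnitRow`)
  have hΘd' : Valued.v Θ.det = Valued.v (toPlace v w k₀) := by rw [hΘd, hϖ, hιv, hk₀]
  have hgateV := gateV_inertPlace_wildUnitRow c v hc hunr w hw w₁ haF hk₀ s' hθ hθv hs'ι hs's' hs'v hnorm1 J hJ hJh cfr φb hφb φ' hstar hΘ hΘd' hΘt hlam hφ'x hall
    hcoordlam ι' hι'j hι'ι hι'v hcomm hrE hnE hdw' hw₀' hαr hι'α hfix hι'θne
  -- ### 7. Assembly
  exact ⟨aF, k₀, θ, s', φ', lam, P,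
    ⟨haF, hk₀, hθ, hθv, hcoord, hint, hs'ι, hs'θ, hs's', hs'O, hs'v, hnorm1⟩, ⟨hφ'inj, hstar⟩, ⟨hlam, hφ'x, hK, hall, hcoordlam⟩, ⟨hP, hPx⟩, hgateV⟩

/-- **(B2d) THE PAIR PACKAGE AT AN INERT PLACE, WILD UNIT ROW.**  From the place, the form, the block frame, the integral unitary pair `(g, u)` with its torus identities and
Eisenstein letters, and ★ α2's skew square root of the discriminant (`4·det g = tr g·tr g − y·y·ι d_F`, `d_F = 1 + w_F`, `|4| < |w_F| = q^{−(2k+1)}`, `y ≠ 0`, `σ_w y = −y·σ_w det g`): an eigen-field MODEL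
`M ∕ E` with a place `w₁ ∣ w`, and — in the letters of ★ F5-(0) `ncard_isSelfDualLattice_stable_eq_phiTHn_inertPlace` VERBATIM — the θ-package `aF k₀ θ s̃` (12 letters), the
endoscopic frame `φ` (`Injective φ`, `hstar`), the root `λ` (`hlam hφx hK hall hcoordlam`), an integral ⋆-polynomial `P` (`hP hPx`) and the gate `hgateV`.
[cite: Rogawski1990, §4.9 Lemma 4.9.3 p. 56, Prop. 4.9.1 (b) p. 55] [cite: Neukirch1999, Ch. II (3.4), (5.7)] [cite: SerreLocalFields1979, Ch. I §6; Ch. V §2 Prop. 3] -/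
theorem exists_pairPackage_inertPlace_wildUnitRow
    {F E : Type} [Field F] [NumberField F] [Field E] [NumberField E] [Algebra F E] [Algebra.IsQuadraticExtension F E]
    (c : E ≃ₐ[F] E) (v : HeightOneSpectrum (𝓞 F)) (hc : c ≠ 1) (hunr : Algebra.IsUnramifiedIn (𝓞 E) v.asIdeal)
    (w : PlacesOver E v) (hw : c • w.1 = w.1)
    -- the form and the block frame
    (J : GL (Fin 3) (w.1.adicCompletion E)) (hJ : J ∈ glInt 3 (w.1.adicCompletion E))
    (hJh : ((J : Matrix (Fin 3) (Fin 3) (w.1.adicCompletion E)).map (galAdicCompletionMap (L := E) c hw))ᵀ = J)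
    (cfr : GL (Fin 3) (w.1.adicCompletion E))
    (φb : (Matrix (Fin 2) (Fin 2) (w.1.adicCompletion E) × w.1.adicCompletion E) →ₐ[w.1.adicCompletion E] Matrix (Fin 3) (Fin 3) (w.1.adicCompletion E))
    (hφb : ∀ (g : Matrix (Fin 2) (Fin 2) (w.1.adicCompletion E)) (u : w.1.adicCompletion E),
      φb (g, u) = (cfr : Matrix (Fin 3) (Fin 3) (w.1.adicCompletion E)) *
        Matrix.reindex endoPerm endoPerm (Matrix.fromBlocks g 0 0 (u • (1 : Matrix (Fin 1) (Fin 1) (w.1.adicCompletion E)))) *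
        ((cfr⁻¹ : GL (Fin 3) (w.1.adicCompletion E)) : Matrix (Fin 3) (Fin 3) (w.1.adicCompletion E)))
    -- the integral unitary pair, its torus identities, its Eisenstein letters
    {g : Matrix (Fin 2) (Fin 2) (w.1.adicCompletion E)} {u : w.1.adicCompletion E}
    (hg : ∀ i j, g i j ∈ 𝒪[w.1.adicCompletion E]) (hu : u ∈ 𝒪[w.1.adicCompletion E]) (hσu : u * galAdicCompletionMap (L := E) c hw u = 1)
    (hτJ : ((φb (g, u)).map (galAdicCompletionMap (L := E) c hw))ᵀ * (J : Matrix (Fin 3) (Fin 3) (w.1.adicCompletion E)) * φb (g, u) = J)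
    (hσD : g.det * galAdicCompletionMap (L := E) c hw g.det = 1)
    (hσt : galAdicCompletionMap (L := E) c hw g.trace = g.trace * galAdicCompletionMap (L := E) c hw g.det)
    {ϖ : w.1.adicCompletion E} (hϖ : Valued.v ϖ = WithZero.exp (-1 : ℤ))
    {Θ : Matrix (Fin 2) (Fin 2) (w.1.adicCompletion E)} {α β : w.1.adicCompletion E}
    (hΘ : Θ = α • 1 + β • g) (hΘd : Valued.v Θ.det = Valued.v ϖ) (hΘt : Valued.v Θ.trace < 1)
    -- ROW W: ★ α2's skew square root of the discriminant
    {y : w.1.adicCompletion E} {dF wF : v.adicCompletion F} {k : ℕ} (hy0 : y ≠ 0) (hdw : dF = 1 + wF)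
    (hwF : Valued.v wF = WithZero.exp (-(2 * (k : ℤ) + 1))) (h4 : Valued.v (4 : v.adicCompletion F) < Valued.v wF)
    (hD4 : 4 * g.det = g.trace * g.trace - y * y * toPlace v w dF)
    (hσy : galAdicCompletionMap (L := E) c hw y = -(y * galAdicCompletionMap (L := E) c hw g.det))
    {ϖF : v.adicCompletion F} (hϖF : Valued.v ϖF = WithZero.exp (-1 : ℤ)) :
    ∃ (M : Type) (_ : Field M) (_ : NumberField M) (_ : Algebra E M) (w₁ : PlacesOver M w.1)
      (aF k₀ : v.adicCompletion F) (θ : w₁.1.adicCompletion M) (s' : w₁.1.adicCompletion M →+* w₁.1.adicCompletion M)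
      (φ : (w.1.adicCompletion E × w₁.1.adicCompletion M) →ₐ[w.1.adicCompletion E] Matrix (Fin 3) (Fin 3) (w.1.adicCompletion E))
      (lam : w₁.1.adicCompletion M) (P : (w.1.adicCompletion E)[X]),
      -- the θ-package (★ F5-(0)'s letters `haF hk₀ hθ hθv hcoord hint hs'ι hs'θ hs's' hs'O hs'v hnorm1`)
      (Valued.v aF < 1 ∧ Valued.v k₀ = WithZero.exp (-1 : ℤ) ∧
        θ ^ 2 = toPlace w.1 w₁ (toPlace v w aF) * θ + toPlace w.1 w₁ (toPlace v w k₀) ∧ Valued.v θ = WithZero.exp (-1 : ℤ) ∧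
        (∀ z : w₁.1.adicCompletion M, ∃! pq : w.1.adicCompletion E × w.1.adicCompletion E, z = toPlace w.1 w₁ pq.1 + toPlace w.1 w₁ pq.2 * θ) ∧
        (∀ p q : w.1.adicCompletion E, toPlace w.1 w₁ p + toPlace w.1 w₁ q * θ ∈ 𝒪[w₁.1.adicCompletion M] ↔
          p ∈ 𝒪[w.1.adicCompletion E] ∧ q ∈ 𝒪[w.1.adicCompletion E]) ∧
        (∀ x, s' (toPlace w.1 w₁ x) = toPlace w.1 w₁ (galAdicCompletionMap (L := E) c hw x)) ∧ s' θ = θ ∧ (∀ z, s' (s' z) = z) ∧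
        (∀ z : 𝒪[w₁.1.adicCompletion M], s' z ∈ 𝒪[w₁.1.adicCompletion M]) ∧ (∀ z, Valued.v (s' z) = Valued.v z) ∧
        (∀ c₁ : w₁.1.adicCompletion M, c₁ ≠ 0 → s' c₁ = c₁ → Even (WithZero.log (Valued.v c₁)) → ∃ a : w₁.1.adicCompletion M, a * s' a * c₁ = 1)) ∧
      -- the endoscopic frame (`hφ hstar`)
      (Function.Injective φ ∧
        (∀ b : w.1.adicCompletion E × w₁.1.adicCompletion M, (J : Matrix (Fin 3) (Fin 3) (w.1.adicCompletion E)) *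
          φ (RingHom.prodMap (galAdicCompletionMap (L := E) c hw) s' b) = ((φ b).map (galAdicCompletionMap (L := E) c hw))ᵀ * J)) ∧
      -- the root (`hlam hφx hK hall hcoordlam`)
      (lam ^ 2 - toPlace w.1 w₁ g.trace * lam + toPlace w.1 w₁ g.det = 0 ∧
        φ ((u, lam) : w.1.adicCompletion E × w₁.1.adicCompletion M) = φb (g, u) ∧
        IsUnit (Matrix.of fun i j : Fin 3 => (((φb (g, u)) ^ (j : ℕ)) *ᵥ ((cfr : Matrix (Fin 3) (Fin 3) (w.1.adicCompletion E)) *ᵥ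
          (Pi.single (endoPerm (Sum.inl 0)) (1 : w.1.adicCompletion E) + Pi.single (endoPerm (Sum.inr 0)) (1 : w.1.adicCompletion E)))) i).det ∧
        (∀ x : w.1.adicCompletion E × w₁.1.adicCompletion M, ∃ Q : (w.1.adicCompletion E)[X],
          aeval ((u, lam) : w.1.adicCompletion E × w₁.1.adicCompletion M) Q = x) ∧
        (∀ z : w₁.1.adicCompletion M, ∃ p q : w.1.adicCompletion E, z = toPlace w.1 w₁ p + toPlace w.1 w₁ q * lam)) ∧
      -- the ⋆-polynomial (`hP hPx`)
      ((∀ i, P.coeff i ∈ 𝒪[w.1.adicCompletion E]) ∧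
        aeval ((u, lam) : w.1.adicCompletion E × w₁.1.adicCompletion M) P = (galAdicCompletionMap (L := E) c hw u, s' lam)) ∧
      -- the gate (`hgateV`)
      (∀ (u' p' q' t' D' : w.1.adicCompletion E) (N'' b' : ℕ),
        ((u', toPlace w.1 w₁ p' + toPlace w.1 w₁ q' * θ) : w.1.adicCompletion E × w₁.1.adicCompletion M) *
          RingHom.prodMap (galAdicCompletionMap (L := E) c hw) s'
            ((u', toPlace w.1 w₁ p' + toPlace w.1 w₁ q' * θ) : w.1.adicCompletion E × w₁.1.adicCompletion M) = 1 →
        Valued.v (u' - 1) < 1 → Valued.v (p' - 1) < 1 → Valued.v q' = WithZero.exp (-(N'' : ℤ)) →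
        (toPlace w.1 w₁ p' + toPlace w.1 w₁ q' * θ) ^ 2 - toPlace w.1 w₁ t' * (toPlace w.1 w₁ p' + toPlace w.1 w₁ q' * θ) + toPlace w.1 w₁ D' = 0 →
        Valued.v (u' * u' - t' * u' + D') = WithZero.exp (-(b' : ℤ)) →
        ((∃ x : Fin 3 → w.1.adicCompletion E, ∃ g₁ ∈ unitaryGroupOfForm (galAdicCompletionMap (L := E) c hw) (J : Matrix (Fin 3) (Fin 3) (w.1.adicCompletion E)),
          Submodule.span 𝒪[w.1.adicCompletion E] (Set.range fun k : Fin 3 =>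
            ((φ ((u', toPlace w.1 w₁ p' + toPlace w.1 w₁ q' * θ) : w.1.adicCompletion E × w₁.1.adicCompletion M)) ^ (k : ℕ)) *ᵥ x) =
            Submodule.span 𝒪[w.1.adicCompletion E] (Set.range ((g₁ : Matrix (Fin 3) (Fin 3) (w.1.adicCompletion E)))ᵀ)) ↔
        Even (WithZero.log (Valued.v (∑ k, ∑ i,
          galAdicCompletionMap (L := E) c hw (((cfr : Matrix (Fin 3) (Fin 3) (w.1.adicCompletion E)) *ᵥ Pi.single (endoPerm (Sum.inr 0)) (1 : w.1.adicCompletion E)) i) *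
          (J : Matrix (Fin 3) (Fin 3) (w.1.adicCompletion E)) i k *
          ((cfr : Matrix (Fin 3) (Fin 3) (w.1.adicCompletion E)) *ᵥ Pi.single (endoPerm (Sum.inr 0)) (1 : w.1.adicCompletion E)) k)) + b'))) := by
  -- the place; `ι d_F` is a non-square (else `χ_g` has the root `(tr g + y·r)∕2`)
  have hιv : ∀ z : v.adicCompletion F, Valued.v (toPlace v w z) = Valued.v z :=
    fun z => Literature.NumberTheory.Automorphic.Liu2021.LemD1IndexedNonVacuityInertCofinite.valued_toPlace_of_isUnramifiedIn E v hunr w z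
  have hd1 : Valued.v (toPlace v w dF) = 1 := by
    rw [hdw, map_add, map_one]
    refine Valuation.map_one_add_of_lt _ ?_
    rw [hιv, hwF, ← WithZero.exp_zero]; exact WithZero.exp_lt_exp.2 (by omega)
  have hd0 : toPlace v w dF ≠ 0 := fun h0 => by rw [h0, map_zero] at hd1; exact zero_ne_one hd1
  haveI : CharZero (w.1.adicCompletion E) := charZero_of_injective_algebraMap (algebraMap E (w.1.adicCompletion E)).injective
  obtain ⟨-, -, hirr, -⟩ := charpoly_ne_zero_of_eisensteinData hϖ hΘ hΘd hΘt
  have hns : ¬ IsSquare (toPlace v w dF) := by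
    rintro ⟨r, hr⟩
    refine hirr ((g.trace + y * r) / 2) ?_
    have h4 : (4 : w.1.adicCompletion E) ≠ 0 := by
      rw [show (4 : w.1.adicCompletion E) = 2 * 2 by norm_num]; exact mul_ne_zero two_ne_zero two_ne_zero
    have hx : ((g.trace + y * r) / 2) * ((g.trace + y * r) / 2) - g.trace * ((g.trace + y * r) / 2) + g.det =
        (4 * g.det - (g.trace * g.trace - y * y * (r * r))) / 4 := by
      field_simp
      ring
    rw [hx, ← hr, hD4, sub_self, zero_div]
  -- ★ (G): a global `m ∈ E` in the square class of `ι d_F` (any residue characteristic), a non-square; ★ (QM): `M = E(√m)` with its involution, `w₁ ∣ w`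
  obtain ⟨m, hm0, hsq⟩ := exists_isSquare_inv_mul_coe_of_ne_zero w.1 (d := toPlace v w dF) hd0
  have hnsq : ¬ IsSquare m := by
    refine not_isSquare_of_not_isSquare_algebraMap (w := w.1) m ?_
    rintro ⟨r, hr⟩
    apply hns
    obtain ⟨s, hs⟩ := hsq
    have hs0 : s ≠ 0 := fun h0 => by
      rw [h0, mul_zero, mul_eq_zero] at hs
      rcases hs with h | h
      · exact (inv_ne_zero hd0) h
      · exact ((map_ne_zero_iff _ (algebraMap E (w.1.adicCompletion E)).injective).2 hm0) h
    refine ⟨r / s, ?_⟩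
    have key : toPlace v w dF * (s * s) = r * r := by rw [← hs, ← mul_assoc, mul_inv_cancel₀ hd0, one_mul, ← hr]
    field_simp
    linear_combination key
  haveI : Fact (Irreducible (X ^ 2 - C m : E[X])) := ⟨irreducible_X_sq_sub_C_of_not_isSquare m hnsq⟩
  haveI : NumberField (AdjoinRoot (X ^ 2 - C m : E[X])) := numberField_adjoinRoot m
  haveI : Algebra.IsQuadraticExtension E (AdjoinRoot (X ^ 2 - C m : E[X])) := isQuadraticExtension_adjoinRoot m
  obtain ⟨c₁, hc₁, -⟩ := exists_algEquiv_root_eq_neg m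
  have hδ0 : AdjoinRoot.root (X ^ 2 - C m : E[X]) ≠ 0 := root_X_sq_sub_C_ne_zero m
  have hmδ : algebraMap E (AdjoinRoot (X ^ 2 - C m : E[X])) m = (AdjoinRoot.root (X ^ 2 - C m : E[X])) ^ 2 := (root_X_sq_sub_C_sq m).symm
  obtain ⟨w₁⟩ : Nonempty (PlacesOver (AdjoinRoot (X ^ 2 - C m : E[X])) w.1) := inferInstance
  have hdm : IsSquare ((toPlace v w dF)⁻¹ * (m : w.1.adicCompletion E)) := hsq
  obtain ⟨aF, k₀, θ, s', φ, lam, P, hX⟩ := exists_pairPackage_inertPlace_wildUnitRow_of_model c v hc hunr w hw J hJ hJh cfr φb hφb hg hu hσu hτJ hσD hσt hϖ hΘ hΘd hΘt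
    hy0 hdw hwF h4 hD4 hσy hϖF c₁ hc₁ hδ0 hmδ hdm w₁
  exact ⟨AdjoinRoot (X ^ 2 - C m : E[X]), inferInstance, inferInstance, inferInstance, w₁, aF, k₀, θ, s', φ, lam, P, hX⟩

end Literature.NumberTheory.Rogawski1990
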